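import Literature.Analysis.FunctionSpaces.BesselKSmallArgument
import HarnessLib

/-!
# A second-order UPPER bound for `K_2` at small argument with a cutoff:
# `K_2(x) ≤ (2/x²)(1 − (x²/4 − x⁴/(32T))/(T + 1))` for every `T ≥ x²/8`

Topic `Literature/Analysis/FunctionSpaces`; a proofs-only sibling of `BesselKSmallArgument.lean` (lit-3: DLMF 10.32.10 for
the tree's real `besselKReal`, the leading-order integer-order enclosures `2/x² − 1/2 ≤ K_2(x) ≤ 2/x²`, and §8 there: the
quadratic step `e^{−s} ≤ 1 − s + s²/2` gives a second-order upper bound ONLY for `ν > 2`, because at `ν = 2` the `s²`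
term is not integrable at `t → 0⁺` — the true next term of `K_2` is `(x²/8)ln(2/x)`, DLMF 10.31.1).  Written by the venture
ladder GRIDFUSION's seat gridfusion-model-6 (g7, 2026-08-27) for the `m = 2` wall factors of the resistive-wall-mode rows
(`ScrewPinchWallFactor.lean` §9/§11; `Summits/Ventures/FusionMHD/Models/RwmFRS1Kq07Bessel.lean`), where the leading-order
`K_2` enclosure (relative width `x²/4`) dominated every bracket.

## What is proved (no definitions, no named facts)
A CUTOFF repairs the `ν = 2` case: in `K_2(x) = (2/x²)∫₀^∞ t e^{−t} e^{−x²/(4t)} dt` (10.32.10) use the quadratic bound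
only for `t ≥ T` and the monotone bound `e^{−x²/(4t)} ≤ e^{−x²/(4T)} ≤ 1 − κ` below `T`, and replace the resulting
`min(t, T)` by the smooth minorant `T(1 − e^{−t/T})` so that every integral is elementary (`Γ(2) = 1`, `∫₀^∞e^{−t} = 1`,
`∫₀^∞ e^{−(1+1/T)t} = T/(T+1)`):
* ★ `besselKReal_two_le_cutoff` — for `x > 0`, `T > 0`, `T ≥ x²/8`:
  `K_2(x) ≤ (2/x²)·(1 − (x²/4 − x⁴/(32T))/(T + 1))`.
Numerically (not part of any statement): at `x = 13/50`, `T = 1/10` the bound is `29.170` against the leading-order `29.586`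
and the lower bound `29.086` (true value `29.105`); the optimal `T ≈ x/(2√2)` gives relative width `≈ 0.3 %` at `x ≤ 0.35`,
i.e. the `m = 2` wall-factor brackets tighten from `±2 %` to `±0.4 %`.

## References
* [DLMF] §10.32 (10.32.10), §10.30 (10.30.2), §10.31 (10.31.1) — as in `BesselKSmallArgument.lean`.
-/

noncomputable section

open MeasureTheory Set Real Filter

namespace Literature.Analysis.FunctionSpaces

/-- `e^{−s} ≤ 1 − s + s²/2` for `s ≥ 0` (the quadratic Taylor bound; `g(s) = 1 − s + s²/2 − e^{−s}` is non-decreasing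
with `g(0) = 0`). [folklore] -/
private theorem exp_neg_le_one_sub_add_sq {s : ℝ} (hs : 0 ≤ s) : Real.exp (-s) ≤ 1 - s + s ^ 2 / 2 := by
  let g : ℝ → ℝ := fun s => 1 - s + s ^ 2 / 2 - Real.exp (-s)
  have hderiv : ∀ u : ℝ, HasDerivAt g (-1 + u + Real.exp (-u)) u := by
    intro u
    have h1 : HasDerivAt (fun s : ℝ => 1 - s + s ^ 2 / 2) (-1 + u) u := by
      have h := ((hasDerivAt_const u (1 : ℝ)).sub (hasDerivAt_id u)).add ((hasDerivAt_pow 2 u).div_const 2)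
      refine (h.congr_of_eventuallyEq (Filter.Eventually.of_forall fun s => ?_)).congr_deriv ?_
      · simp [id]
      · norm_num
    have h2 : HasDerivAt (fun s : ℝ => Real.exp (-s)) (Real.exp (-u) * -1) u := (hasDerivAt_neg u).exp
    exact (h1.sub h2).congr_deriv (by ring)
  have hmono : Monotone g := by
    refine monotone_of_deriv_nonneg (fun u => (hderiv u).differentiableAt) fun u => ?_
    rw [(hderiv u).deriv]
    have := Real.add_one_le_exp (-u)
    linarith
  have h0 : g 0 = 0 := by simp [g]
  have := hmono hs
  rw [h0] at this
  simp only [g] at this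
  linarith

/-- The pointwise majorant behind the cutoff bound: for `t > 0`, `T ≥ a/2 > 0` (`κT := a − a²/(2T) ≥ 0`),
`t·e^{−a/t} ≤ t − (a − a²/(2T))·(1 − e^{−t/T})`. [folklore] -/
private theorem mul_exp_neg_div_le {a T t : ℝ} (ha : 0 ≤ a) (hT : 0 < T) (haT : a / 2 ≤ T) (ht : 0 < t) :
    t * Real.exp (-(a / t)) ≤ t - (a - a ^ 2 / (2 * T)) * (1 - Real.exp (-(t / T))) := by
  have hκ : 0 ≤ a - a ^ 2 / (2 * T) := by
    have : a ^ 2 / (2 * T) ≤ a := by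
      rw [div_le_iff₀ (by positivity)]; nlinarith
    linarith
  have hexpT : 0 < Real.exp (-(t / T)) := Real.exp_pos _
  have hexp1 : Real.exp (-(t / T)) ≤ 1 := Real.exp_le_one_iff.mpr (by
    have : 0 < t / T := div_pos ht hT
    linarith)
  rcases le_or_gt T t with hTt | htT
  · -- `t ≥ T`: quadratic bound at `s = a/t`, then `a²/(2t) ≤ a²/(2T)`
    have hs : 0 ≤ a / t := by positivity
    have hq := exp_neg_le_one_sub_add_sq hs
    have h1 : t * Real.exp (-(a / t)) ≤ t - a + a ^ 2 / (2 * t) := by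
      have := mul_le_mul_of_nonneg_left hq ht.le
      have e : t * (1 - a / t + (a / t) ^ 2 / 2) = t - a + a ^ 2 / (2 * t) := by
        field_simp
      linarith [e]
    have h2 : a ^ 2 / (2 * t) ≤ a ^ 2 / (2 * T) :=
      div_le_div_of_nonneg_left (by positivity) (by positivity) (by linarith)
    have h3 : (a - a ^ 2 / (2 * T)) * (1 - Real.exp (-(t / T))) ≤ a - a ^ 2 / (2 * T) := by
      have := mul_le_mul_of_nonneg_left (show 1 - Real.exp (-(t / T)) ≤ 1 by linarith) hκ
      linarith
    linarith
  · -- `t < T`: monotone bound `e^{−a/t} ≤ e^{−a/T} ≤ 1 − κ`, and `T(1 − e^{−t/T}) ≤ t`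
    have hmono : Real.exp (-(a / t)) ≤ Real.exp (-(a / T)) := by
      rw [Real.exp_le_exp]
      have : a / T ≤ a / t := div_le_div_of_nonneg_left ha ht htT.le
      linarith
    have hq := exp_neg_le_one_sub_add_sq (show 0 ≤ a / T by positivity)
    have hk : Real.exp (-(a / t)) ≤ 1 - (a - a ^ 2 / (2 * T)) / T := by
      have e : 1 - a / T + (a / T) ^ 2 / 2 = 1 - (a - a ^ 2 / (2 * T)) / T := by
        field_simp
        ring
      linarith [e]
    have h1 : t * Real.exp (-(a / t)) ≤ t - (a - a ^ 2 / (2 * T)) * (t / T) := by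
      have := mul_le_mul_of_nonneg_left hk ht.le
      have e : t * (1 - (a - a ^ 2 / (2 * T)) / T) = t - (a - a ^ 2 / (2 * T)) * (t / T) := by
        field_simp
      linarith [e]
    -- `1 − e^{−u} ≤ u`
    have hu : 1 - Real.exp (-(t / T)) ≤ t / T := by
      have := Real.add_one_le_exp (-(t / T))
      linarith
    have h2 : (a - a ^ 2 / (2 * T)) * (1 - Real.exp (-(t / T))) ≤ (a - a ^ 2 / (2 * T)) * (t / T) :=
      mul_le_mul_of_nonneg_left hu hκ
    linarith

/-- ★ **Second-order cutoff bound for `K_2`**: for `x > 0` and every `T ≥ x²/8`,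
`K_2(x) ≤ (2/x²)·(1 − (x²/4 − x⁴/(32T))/(T + 1))` (10.32.10 with `e^{−s} ≤ 1 − s + s²/2` on `t ≥ T` only).
[cite: DLMF, 10.32.10] [cite: DLMF, 10.30.2] -/
theorem besselKReal_two_le_cutoff {x T : ℝ} (hx : 0 < x) (hT : 0 < T) (hxT : x ^ 2 / 8 ≤ T) :
    besselKReal 2 x ≤ 2 / x ^ 2 * (1 - (x ^ 2 / 4 - x ^ 4 / (32 * T)) / (T + 1)) := by
  obtain ⟨hval, hint⟩ := integral_rpow_mul_exp_eq_besselKReal 2 hx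
  set a : ℝ := x ^ 2 / 4 with ha_def
  have ha : 0 ≤ a := by positivity
  have haT : a / 2 ≤ T := by rw [ha_def]; linarith
  set c : ℝ := a - a ^ 2 / (2 * T) with hc_def
  have hc : 0 ≤ c := by
    have : a ^ 2 / (2 * T) ≤ a := by rw [div_le_iff₀ (by positivity)]; nlinarith
    linarith
  have hb : 0 < 1 + 1 / T := by positivity
  -- the three elementary integrals
  have hG : IntegrableOn (fun t : ℝ => Real.exp (-t) * t ^ ((2 : ℝ) - 1)) (Ioi 0) :=
    Real.GammaIntegral_convergent two_pos
  have hGval : ∫ t in Ioi (0 : ℝ), Real.exp (-t) * t ^ ((2 : ℝ) - 1) = 1 := by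
    rw [← Real.Gamma_eq_integral two_pos, Real.Gamma_two]
  have hE1 : IntegrableOn (fun t : ℝ => Real.exp (-1 * t)) (Ioi 0) := exp_neg_integrableOn_Ioi 0 one_pos
  have hE1val : ∫ t in Ioi (0 : ℝ), Real.exp (-1 * t) = 1 := by
    have h := integral_exp_mul_Ioi (show (-1 : ℝ) < 0 by norm_num) 0
    simp only [mul_zero, Real.exp_zero] at h
    rw [h]; norm_num
  have hE2 : IntegrableOn (fun t : ℝ => Real.exp (-(1 + 1 / T) * t)) (Ioi 0) := exp_neg_integrableOn_Ioi 0 hb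
  have hE2val : ∫ t in Ioi (0 : ℝ), Real.exp (-(1 + 1 / T) * t) = T / (T + 1) := by
    have h := integral_exp_mul_Ioi (show -(1 + 1 / T) < (0 : ℝ) by linarith) 0
    simp only [mul_zero, Real.exp_zero] at h
    rw [h]
    field_simp
  -- the majorant `M(t) = t e^{−t} − c e^{−t} + c e^{−(1+1/T)t}` and its integral `1 − c + cT/(T+1)`
  have hFG : IntegrableOn (fun t : ℝ => Real.exp (-t) * t ^ ((2 : ℝ) - 1) - c * Real.exp (-1 * t)) (Ioi 0) :=
    hG.sub (hE1.const_mul c)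
  have hMint : IntegrableOn (fun t : ℝ => Real.exp (-t) * t ^ ((2 : ℝ) - 1) - c * Real.exp (-1 * t)
      + c * Real.exp (-(1 + 1 / T) * t)) (Ioi 0) :=
    hFG.add (hE2.const_mul c)
  have hMval : ∫ t in Ioi (0 : ℝ), (Real.exp (-t) * t ^ ((2 : ℝ) - 1) - c * Real.exp (-1 * t)
      + c * Real.exp (-(1 + 1 / T) * t)) = 1 - c + c * (T / (T + 1)) := by
    rw [integral_add hFG (hE2.const_mul c), integral_sub hG (hE1.const_mul c), integral_const_mul,
      integral_const_mul, hGval, hE1val, hE2val]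
    ring
  -- pointwise comparison on `(0, ∞)`
  have hle : (∫ t in Ioi (0 : ℝ), t ^ ((2 : ℝ) - 1) * Real.exp (-(1 * t + x ^ 2 / 4 / t))) ≤
      ∫ t in Ioi (0 : ℝ), (Real.exp (-t) * t ^ ((2 : ℝ) - 1) - c * Real.exp (-1 * t)
        + c * Real.exp (-(1 + 1 / T) * t)) := by
    refine setIntegral_mono_on hint hMint measurableSet_Ioi fun t ht => ?_
    have ht : (0 : ℝ) < t := ht
    have hp : t ^ ((2 : ℝ) - 1) = t := by norm_num
    rw [hp]
    have key := mul_exp_neg_div_le ha hT haT ht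
    rw [← hc_def] at key
    have e1 : Real.exp (-(1 * t + x ^ 2 / 4 / t)) = Real.exp (-t) * Real.exp (-(a / t)) := by
      rw [← Real.exp_add]; congr 1; rw [ha_def]; ring
    have e2 : Real.exp (-(1 + 1 / T) * t) = Real.exp (-t) * Real.exp (-(t / T)) := by
      rw [← Real.exp_add]; congr 1; field_simp; ring
    have e3 : Real.exp (-1 * t) = Real.exp (-t) := by ring_nf
    rw [e1, e2, e3]
    have hpos : 0 < Real.exp (-t) := Real.exp_pos _
    calc t * (Real.exp (-t) * Real.exp (-(a / t))) = Real.exp (-t) * (t * Real.exp (-(a / t))) := by ring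
      _ ≤ Real.exp (-t) * (t - c * (1 - Real.exp (-(t / T)))) := mul_le_mul_of_nonneg_left key hpos.le
      _ = Real.exp (-t) * t - c * Real.exp (-t) + c * (Real.exp (-t) * Real.exp (-(t / T))) := by ring
  -- assemble: `(x²/2) K₂ ≤ 1 − c/(T+1)`
  rw [hval, hMval] at hle
  have hx2 : (x / 2) ^ (2 : ℝ) = x ^ 2 / 4 := by
    rw [Real.rpow_two]; ring
  rw [hx2] at hle
  have hT1 : 0 < T + 1 := by linarith
  have hfrac : 1 - c + c * (T / (T + 1)) = 1 - c / (T + 1) := by field_simp; ring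
  have hK : x ^ 2 / 2 * besselKReal 2 x ≤ 1 - c / (T + 1) := by nlinarith [hle, hfrac]
  have hc' : x ^ 2 / 4 - x ^ 4 / (32 * T) = c := by
    rw [hc_def, ha_def]; field_simp; ring
  rw [hc']
  have hx0 : x ≠ 0 := hx.ne'
  have h2x : 0 ≤ 2 / x ^ 2 := by positivity
  calc besselKReal 2 x = 2 / x ^ 2 * (x ^ 2 / 2 * besselKReal 2 x) := by field_simp
    _ ≤ 2 / x ^ 2 * (1 - c / (T + 1)) := mul_le_mul_of_nonneg_left hK h2x

end Literature.Analysis.FunctionSpaces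

end
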